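import Literature.NumberTheory.Transcendental.GaGmSubgroupDegrees
import HarnessLib

/-!
# The multiplicity of a codimension-one subgroup `𝔾ₐ × T_λ` (conclusion (ii) of
`Philippon1986_GaGm_P1n`)

Topic `Literature/NumberTheory/Transcendental`. Input for the discharge of the named fact
`Philippon1986_GaGm_P1n` (`PhilipponZeroEstimateP1n.lean`, Philippon 1986 Thm 2.1 at `T = 0` on
`G = 𝔾ₐ × 𝔾ₘⁿ ⊂ (ℙ¹)ⁿ⁺¹`), built on `GaGmZariski` / `GaGmBezout` / `GaGmSubgroups` /
`GaGmSubgroupDegrees`. Everything here is PROVED; no named facts.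

For an irreducible closed subgroup `H₀ = 𝔾ₐ × T_A ≤ ℂ × (ℂˣ)ⁿ` whose character lattice is cyclic,
`A = charGroup H₀ = ℤλ`, we prove the lower bound
`GaGm.factorial_mul_le_mult_of_charGroup_eq_zmultiples`:
`n! · D₀ · D₁ⁿ⁻¹ · ∑_h |λ_h| ≤ mult_{D₀,D₁}(H₀)`,
which is Philippon's value `H(G'; D₀, D₁, …, D₁) = n!·D₀D₁ⁿ⁻¹·∑_h|λ_h|` of the closure
`ℙ¹ × {y^{λ⁺} = y^{λ⁻}}` of `G'` in `(ℙ¹)ⁿ⁺¹` (§3 (*) p. 362 with Lemme 3.4: the bidegree-`α`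
degrees of the hypersurface `y^{λ⁺} = y^{λ⁻}` are the `|λ_h|`), read as an inequality for the
multiplicity `GaGm.mult` of `GaGmBezout.lean`; dividing the Bézout inequality
`card · mult(H₀) ≤ (n+1)! D₀ D₁ⁿ` by `n!` then gives conclusion (ii) of `Philippon1986_GaGm_P1n`.

Proof: the box monomials `X^i Y^c`, `i ≤ tD₀`, `c` running over the `λ`-minimal exponents
`R_t = {c ∈ [0, tD₁]ⁿ ; c - λ ∉ [0, tD₁]ⁿ}` are linearly independent modulo `𝔍(H₀)` (two
`λ`-minimal exponents congruent modulo `ℤλ` coincide, by convexity of the box; then the polynomial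
identity in `X` and Artin's independence of the characters of `H₀`, as in
`GaGm.pow_mul_pow_le_hilb`), so `H_{H₀}(t) ≥ (tD₀+1)·#R_t`; counting `R_t` by the first coordinate
`h` at which `c - λ` leaves the box gives `#R_t ≥ (∑_h |λ_h|)·(tD₁ + 1 - ∑_h|λ_h|)ⁿ⁻¹`; finally
`dim H₀ = n` (`GaGm.dimG_eq_addDim_add_torusDim`) and the comparison of leading coefficients
`GaGm.Asymp.sum_le_of_choose_ineq` against the sandwich `GaGm.HasMult`.

## References

* P. Philippon, *Lemmes de zéros dans les groupes algébriques commutatifs*, Bull. Soc. Math.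
  France 114 (1986), 355–383, Thm 2.1 (p. 358), §3 (*) p. 362, Lemme 3.4 p. 371. [Philippon1986]
* Yu. V. Nesterenko, P. Philippon (eds.), LNM 1752 (2001), Ch. 11 (D. Roy), §2.2, §4.
  [NesterenkoPhilippon2001]
-/

noncomputable section

open MvPolynomial Module
open scoped Pointwise

namespace Literature.NumberTheory.Transcendental

namespace GaGm

variable {n : ℕ}

namespace MultBound

/-! ### The `λ`-minimal exponents of a box and their number -/

/-- The exponent box `[0, N]ⁿ`. [folklore] -/
def ebox (n N : ℕ) : Finset (Fin n → ℕ) := Fintype.piFinset fun _ => Finset.range (N + 1)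

/-- Membership in the exponent box. [folklore] -/
theorem mem_ebox_iff {N : ℕ} {c : Fin n → ℕ} : c ∈ ebox n N ↔ ∀ j, c j ≤ N := by
  simp [ebox, Fintype.mem_piFinset]

/-- `c - λ` stays in the box `[0, N]ⁿ` at the coordinate `j`. [folklore] -/
def StaysAt (N : ℕ) (lam : Fin n → ℤ) (c : Fin n → ℕ) (j : Fin n) : Prop :=
  0 ≤ (c j : ℤ) - lam j ∧ (c j : ℤ) - lam j ≤ N

/-- `StaysAt` is decidable (a conjunction of integer inequalities). [folklore] -/
instance decidableStaysAt (N : ℕ) (lam : Fin n → ℤ) (c : Fin n → ℕ) (j : Fin n) : Decidable (StaysAt N lam c j) := by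
  unfold StaysAt; infer_instance

/-- The `λ`-minimal exponents of the box: those `c` with `c - λ ∉ [0, N]ⁿ`. [folklore] -/
def minExp (N : ℕ) (lam : Fin n → ℤ) : Finset (Fin n → ℕ) :=
  (ebox n N).filter fun c => ¬ ∀ j, StaysAt N lam c j

/-- Membership in `minExp`. [folklore] -/
theorem mem_minExp_iff {N : ℕ} {lam : Fin n → ℤ} {c : Fin n → ℕ} :
    c ∈ minExp N lam ↔ (∀ j, c j ≤ N) ∧ ¬ ∀ j, StaysAt N lam c j := by
  rw [minExp, Finset.mem_filter, mem_ebox_iff]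

/-- **Two `λ`-minimal exponents congruent modulo `ℤλ` are equal** (convexity of the box).
[folklore] -/
theorem eq_of_sub_eq_zsmul {N : ℕ} {lam : Fin n → ℤ} {c c' : Fin n → ℕ} (hc : c ∈ minExp N lam)
    (hc' : c' ∈ minExp N lam) {k : ℤ} (h : ∀ j, (c' j : ℤ) - c j = k * lam j) : c = c' := by
  rw [mem_minExp_iff] at hc hc'
  -- `k ≥ 1` is impossible: `c' - λ = c + (k-1)λ` would lie in the box
  have hk1 : ¬ 1 ≤ k := by
    intro hk
    apply hc'.2
    intro j
    have h1 := h j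
    have hcj : (c j : ℤ) ≤ N := by exact_mod_cast hc.1 j
    have hc'j : (c' j : ℤ) ≤ N := by exact_mod_cast hc'.1 j
    have h0 : (0 : ℤ) ≤ c j := by positivity
    have h0' : (0 : ℤ) ≤ c' j := by positivity
    constructor
    · -- `c' j - lam j = c j + (k - 1) lam j ≥ 0`
      by_cases hl : 0 ≤ lam j
      · have : 0 ≤ (k - 1) * lam j := mul_nonneg (by omega) hl
        linarith
      · linarith
    · by_cases hl : 0 ≤ lam j
      · linarith
      · have : (k - 1) * lam j ≤ 0 := mul_nonpos_of_nonneg_of_nonpos (by omega) (by omega)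
        linarith
  -- `k ≤ -1` is impossible symmetrically: `c - λ = c' + (-k-1)λ` would lie in the box
  have hk2 : ¬ k ≤ -1 := by
    intro hk
    apply hc.2
    intro j
    have h1 := h j
    have hcj : (c j : ℤ) ≤ N := by exact_mod_cast hc.1 j
    have hc'j : (c' j : ℤ) ≤ N := by exact_mod_cast hc'.1 j
    have h0 : (0 : ℤ) ≤ c j := by positivity
    have h0' : (0 : ℤ) ≤ c' j := by positivity
    constructor
    · by_cases hl : 0 ≤ lam j
      · have : 0 ≤ (-k - 1) * lam j := mul_nonneg (by omega) hl
        linarith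
      · linarith
    · by_cases hl : 0 ≤ lam j
      · linarith
      · have : (-k - 1) * lam j ≤ 0 := mul_nonpos_of_nonneg_of_nonpos (by omega) (by omega)
        linarith
  have hk0 : k = 0 := by omega
  funext j
  have := h j
  rw [hk0, zero_mul, sub_eq_zero] at this
  exact_mod_cast this.symm

/-- The number of `c ∈ [0, N]` with `c - l ∈ [0, N]` is `N + 1 - |l|`. [folklore] -/
theorem card_filter_stays (N : ℕ) (l : ℤ) :
    ((Finset.range (N + 1)).filter fun c : ℕ => 0 ≤ (c : ℤ) - l ∧ (c : ℤ) - l ≤ N).card = N + 1 - l.natAbs := by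
  rcases le_or_gt 0 l with hl | hl
  · -- `l ≥ 0`: the set is `{l, …, N}`, the image of `range (N + 1 - l)` under `· + l`
    obtain ⟨m, rfl⟩ := Int.eq_ofNat_of_zero_le hl
    have : ((Finset.range (N + 1)).filter fun c : ℕ => 0 ≤ (c : ℤ) - (m : ℤ) ∧ (c : ℤ) - (m : ℤ) ≤ N) =
        (Finset.range (N + 1 - m)).map (addRightEmbedding m) := by
      ext c
      simp only [Finset.mem_filter, Finset.mem_range, Finset.mem_map, addRightEmbedding_apply]
      constructor
      · rintro ⟨hc, h1, -⟩
        refine ⟨c - m, ?_, ?_⟩ <;> omega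
      · rintro ⟨a, ha, rfl⟩
        refine ⟨by omega, by push_cast; omega, by push_cast; omega⟩
    rw [this, Finset.card_map, Finset.card_range, Int.natAbs_natCast]
  · -- `l < 0`: the set is `{0, …, N + l}`
    have : ((Finset.range (N + 1)).filter fun c : ℕ => 0 ≤ (c : ℤ) - l ∧ (c : ℤ) - l ≤ N) =
        Finset.range (N + 1 - l.natAbs) := by
      ext c
      simp only [Finset.mem_filter, Finset.mem_range]
      have hla : (l.natAbs : ℤ) = -l := by omega
      constructor
      · rintro ⟨-, -, h2⟩; omega
      · intro hc; refine ⟨by omega, by omega, by omega⟩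
    rw [this, Finset.card_range]

/-- The number of `c ∈ [0, N]` with `c - l ∉ [0, N]` is `|l|` when `|l| ≤ N + 1`. [folklore] -/
theorem card_filter_not_stays (N : ℕ) (l : ℤ) (hl : l.natAbs ≤ N + 1) :
    ((Finset.range (N + 1)).filter fun c : ℕ => ¬ (0 ≤ (c : ℤ) - l ∧ (c : ℤ) - l ≤ N)).card = l.natAbs := by
  have h := Finset.card_filter_add_card_filter_not
    (s := Finset.range (N + 1)) (fun c : ℕ => 0 ≤ (c : ℤ) - l ∧ (c : ℤ) - l ≤ N)
  rw [card_filter_stays, Finset.card_range] at h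
  omega

/-- **Counting the `λ`-minimal exponents from below**:
`#R ≥ (∑_h |λ_h|) · (N + 1 - ∑_h |λ_h|)ⁿ⁻¹`. (Split `R` according to the first coordinate `h`
at which `c - λ` leaves the box: that piece is a product set with `|λ_h|` choices at `h`,
`N + 1 - |λ_j|` choices at `j < h` and `N + 1` choices at `j > h`.) [folklore] -/
theorem sum_mul_pow_le_card_minExp (N : ℕ) (lam : Fin n → ℤ)
    (hA : ∑ h, (lam h).natAbs ≤ N + 1) :
    (∑ h, (lam h).natAbs) * (N + 1 - ∑ h, (lam h).natAbs) ^ (n - 1) ≤ (minExp N lam).card := by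
  classical
  set A := ∑ h, (lam h).natAbs with hAdef
  -- the pieces
  let piece : Fin n → Finset (Fin n → ℕ) := fun h =>
    Fintype.piFinset fun j =>
      if j < h then (Finset.range (N + 1)).filter (fun c : ℕ => 0 ≤ (c : ℤ) - lam j ∧ (c : ℤ) - lam j ≤ N)
      else if j = h then (Finset.range (N + 1)).filter (fun c : ℕ => ¬ (0 ≤ (c : ℤ) - lam j ∧ (c : ℤ) - lam j ≤ N))
      else Finset.range (N + 1)
  have hpiece_sub : ∀ h, piece h ⊆ minExp N lam := by
    intro h c hc
    rw [Fintype.mem_piFinset] at hc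
    rw [mem_minExp_iff]
    refine ⟨fun j => ?_, fun hall => ?_⟩
    · have := hc j
      split_ifs at this with h1 h2
      · exact Nat.lt_succ_iff.mp (Finset.mem_range.mp (Finset.mem_filter.mp this).1)
      · exact Nat.lt_succ_iff.mp (Finset.mem_range.mp (Finset.mem_filter.mp this).1)
      · exact Nat.lt_succ_iff.mp (Finset.mem_range.mp this)
    · have := hc h
      rw [if_neg (lt_irrefl h), if_pos rfl, Finset.mem_filter] at this
      exact this.2 (hall h)
  have hdisj : ∀ h₁ h₂, h₁ ≠ h₂ → Disjoint (piece h₁) (piece h₂) := by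
    intro h₁ h₂ hne
    wlog hlt : h₁ < h₂ generalizing h₁ h₂
    · exact (this h₂ h₁ hne.symm (lt_of_le_of_ne (not_lt.mp hlt) hne.symm)).symm
    rw [Finset.disjoint_left]
    intro c hc₁ hc₂
    rw [Fintype.mem_piFinset] at hc₁ hc₂
    have h1 := hc₁ h₁
    have h2 := hc₂ h₁
    rw [if_neg (lt_irrefl h₁), if_pos rfl, Finset.mem_filter] at h1
    rw [if_pos hlt, Finset.mem_filter] at h2
    exact h1.2 h2.2
  -- cardinality of a piece
  have hcard_piece : ∀ h, (lam h).natAbs * (N + 1 - A) ^ (n - 1) ≤ (piece h).card := by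
    intro h
    rw [Fintype.card_piFinset]
    -- compare factor by factor with the constant family
    have hfac : ∀ j, (if j = h then (lam h).natAbs else N + 1 - A) ≤
        (if j < h then (Finset.range (N + 1)).filter (fun c : ℕ => 0 ≤ (c : ℤ) - lam j ∧ (c : ℤ) - lam j ≤ N)
          else if j = h then (Finset.range (N + 1)).filter (fun c : ℕ => ¬ (0 ≤ (c : ℤ) - lam j ∧ (c : ℤ) - lam j ≤ N))
          else Finset.range (N + 1)).card := by
      intro j
      have hj : (lam j).natAbs ≤ A :=
        hAdef ▸ Finset.single_le_sum (f := fun h => (lam h).natAbs) (fun _ _ => Nat.zero_le _) (Finset.mem_univ j)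
      by_cases hjh : j = h
      · subst hjh
        rw [if_pos rfl, if_neg (lt_irrefl _), if_pos rfl, card_filter_not_stays N (lam j) (by omega)]
      · by_cases hlt : j < h
        · rw [if_neg hjh, if_pos hlt, card_filter_stays]; omega
        · rw [if_neg hjh, if_neg hlt, if_neg hjh, Finset.card_range]; omega
    have hcnt : (Finset.univ.filter fun j : Fin n => ¬ j = h).card = n - 1 := by
      have := Finset.card_filter_add_card_filter_not (s := Finset.univ) (fun j : Fin n => j = h)
      rw [Finset.filter_eq', if_pos (Finset.mem_univ h), Finset.card_singleton, Finset.card_univ,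
        Fintype.card_fin] at this
      omega
    calc (lam h).natAbs * (N + 1 - A) ^ (n - 1)
        = ∏ j, (if j = h then (lam h).natAbs else N + 1 - A) := by
          rw [Finset.prod_ite, Finset.prod_const, Finset.prod_const, Finset.filter_eq',
            if_pos (Finset.mem_univ h), Finset.card_singleton, pow_one, hcnt]
      _ ≤ _ := Finset.prod_le_prod (fun _ _ => Nat.zero_le _) fun j _ => hfac j
  -- sum over the pieces
  calc A * (N + 1 - A) ^ (n - 1) = ∑ h, (lam h).natAbs * (N + 1 - A) ^ (n - 1) := by
        rw [hAdef, Finset.sum_mul]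
    _ ≤ ∑ h, (piece h).card := Finset.sum_le_sum fun h _ => hcard_piece h
    _ = (Finset.univ.biUnion piece).card :=
        (Finset.card_biUnion fun h₁ _ h₂ _ hne => hdisj h₁ h₂ hne).symm
    _ ≤ (minExp N lam).card := Finset.card_le_card (Finset.biUnion_subset.mpr fun h _ => hpiece_sub h)

/-! ### The independent box monomials `X^i Y^c`, `c` `λ`-minimal -/

/-- The exponent `(i; c)` of the monomial `X^i Y^c`. [folklore] -/
def consExp {a : ℕ} {R : Finset (Fin n → ℕ)} (ic : Fin a × ↥R) : Fin (n + 1) →₀ ℕ :=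
  Finsupp.equivFunOnFinite.symm (Fin.cons (ic.1 : ℕ) (fun j => (ic.2 : Fin n → ℕ) j))

/-- The `X`-exponent of `consExp`. [folklore] -/
theorem consExp_zero {a : ℕ} {R : Finset (Fin n → ℕ)} (ic : Fin a × ↥R) : consExp ic 0 = ic.1 := by
  simp [consExp]

/-- The `Y`-exponents of `consExp`. [folklore] -/
theorem consExp_succ {a : ℕ} {R : Finset (Fin n → ℕ)} (ic : Fin a × ↥R) (j : Fin n) :
    consExp ic j.succ = (ic.2 : Fin n → ℕ) j := by
  simp [consExp]

/-- `consExp` is injective. [folklore] -/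
theorem consExp_injective {a : ℕ} {R : Finset (Fin n → ℕ)} :
    Function.Injective (consExp (n := n) (a := a) (R := R)) := by
  intro ic ic' h
  refine Prod.ext (Fin.ext ?_) (Subtype.ext (funext fun j => ?_))
  · have := congrArg (fun s => s 0) h; simpa [consExp_zero] using this
  · have := congrArg (fun s => s j.succ) h; simpa [consExp_succ] using this

/-- **Lower bound `H_{H₀}(t) ≥ (tD₀+1)·#R_t`** for an irreducible closed subgroup
`H₀ = 𝔾ₐ × T_{ℤλ}`: the box monomials `X^i Y^c`, `c` `λ`-minimal in `[0, tD₁]ⁿ`, are linearly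
independent modulo `𝔍(H₀)`. [folklore] -/
theorem mul_card_minExp_le_hilb (D₀ D₁ : ℕ) (H₀ : Subgroup (GaGm n)) (hirr : IsIrred (H₀ : Set (GaGm n)))
    (hadd : (toConnAlgSubgroup H₀ hirr).addPart = true) {lam : Fin n → ℤ}
    (hlam : charGroup (H₀ : Set (GaGm n)) = AddSubgroup.zmultiples lam) (t : ℕ) :
    (t * D₀ + 1) * (minExp (t * D₁) lam).card ≤ hilb D₀ D₁ (H₀ : Set (GaGm n)) t := by
  classical
  haveI := hirr.isPrime
  set 𝔭 := vanishing (H₀ : Set (GaGm n)) with h𝔭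
  set R := minExp (n := n) (t * D₁) lam with hR
  let I := Fin (t * D₀ + 1) × ↥R
  set fam : I → MvPolynomial (Fin (n + 1)) ℂ := fun ic => monomial (consExp ic) 1 with hfam
  have hcardI : Fintype.card I = (t * D₀ + 1) * R.card := by
    simp only [I, Fintype.card_prod, Fintype.card_fin, Fintype.card_coe]
  -- they lie in the box
  have hfamBox : ∀ ic, fam ic ∈ Box (n := n) D₀ D₁ t := by
    intro ic
    rw [hfam]
    refine (monomial_mem_restrictSupport ℂ).mpr (Or.inl ⟨?_, fun l => ?_⟩)
    · rw [consExp_zero]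
      have h1 : (ic.1 : ℕ) < t * D₀ + 1 := ic.1.2
      omega
    · rw [consExp_succ]
      exact (mem_minExp_iff.mp ic.2.2).1 l
  -- they are linearly independent
  have hfamli : LinearIndependent ℂ fam := by
    have h := (MvPolynomial.basisMonomials (Fin (n + 1)) ℂ).linearIndependent.comp consExp
      (consExp_injective (n := n) (a := t * D₀ + 1) (R := R))
    have he : (⇑(MvPolynomial.basisMonomials (Fin (n + 1)) ℂ) ∘ consExp) = fam := by
      funext ic
      simp [hfam, MvPolynomial.coe_basisMonomials]
    rw [he] at h
    exact h
  -- the torus points of `H₀`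
  let Hs : Subgroup (GaGm n) :=
    { carrier := {h | h ∈ H₀ ∧ h.1 = 1}
      one_mem' := ⟨H₀.one_mem, rfl⟩
      mul_mem' := fun {u v} hu hv => ⟨H₀.mul_mem hu.1 hv.1, by rw [Prod.fst_mul, hu.2, hv.2, one_mul]⟩
      inv_mem' := fun {u} hu => ⟨H₀.inv_mem hu.1, by rw [Prod.fst_inv, hu.2, inv_one]⟩ }
  have hHs_char : charGroup ((Hs : Subgroup (GaGm n)) : Set (GaGm n)) = charGroup (H₀ : Set (GaGm n)) := by
    ext χ
    simp only [mem_charGroup_iff]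
    constructor
    · intro h k hk
      exact h ((1 : Multiplicative ℂ), k.2) ⟨torusPart_mem H₀ hirr.isClosedG hk, rfl⟩
    · intro h k hk
      exact h k hk.1
  -- for fixed `i`, the characters `c ↦ y^c` of `Hs`, `c ∈ R`, are pairwise distinct
  have hinj : ∀ i : Fin (t * D₀ + 1), Function.Injective (fun c : ↥R => monChar Hs (consExp (i, c))) := by
    intro i c c' hcc
    have hv := sub_mem_charGroup_of_monChar_eq hcc
    rw [hHs_char, hlam, AddSubgroup.mem_zmultiples_iff] at hv
    obtain ⟨k, hk⟩ := hv
    apply Subtype.ext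
    refine eq_of_sub_eq_zsmul c.2 c'.2 (k := k) fun j => ?_
    have := congrFun hk j
    simp only [Pi.smul_apply, smul_eq_mul, consExp_succ] at this
    rw [← this]
  -- their span meets `𝔭` trivially
  have hinf : Submodule.span ℂ (Set.range fam) ⊓ 𝔭.restrictScalars ℂ = ⊥ := by
    rw [Submodule.eq_bot_iff]
    rintro Q ⟨hQ, hQ𝔭⟩
    rw [SetLike.mem_coe, Submodule.mem_span_range_iff_exists_fun] at hQ
    obtain ⟨cf, rfl⟩ := hQ
    -- the value at `(x, y)`
    have hval : ∀ (x : ℂ) (y : Fin n → ℂˣ),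
        evalAt (∑ ic, cf ic • fam ic) (Multiplicative.ofAdd x, y) =
          ∑ i : Fin (t * D₀ + 1), (∑ c : ↥R, cf (i, c) * charVal y (consExp (i, c))) * x ^ (i : ℕ) := by
      intro x y
      rw [evalAt_eq_eval, map_sum, Fintype.sum_prod_type]
      refine Finset.sum_congr rfl fun i _ => ?_
      rw [Finset.sum_mul]
      refine Finset.sum_congr rfl fun c _ => ?_
      rw [hfam]
      dsimp only
      rw [MvPolynomial.smul_eval, ← evalAt_eq_eval, evalAt_monomial, consExp_zero]
      simp only [toAdd_ofAdd, one_mul]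
      ring
    -- Step 1: for every torus point `y` of `H₀` and every `i`, `∑_c cf(i,c) y^{c} = 0`
    have step1 : ∀ y : Fin n → ℂˣ, ((1 : Multiplicative ℂ), y) ∈ H₀ → ∀ i : Fin (t * D₀ + 1),
        ∑ c : ↥R, cf (i, c) * charVal y (consExp (i, c)) = 0 := by
      intro y hy
      set coef : Fin (t * D₀ + 1) → ℂ := fun i => ∑ c : ↥R, cf (i, c) * charVal y (consExp (i, c)) with hcoef
      set Pol : Polynomial ℂ := ∑ i : Fin (t * D₀ + 1), Polynomial.C (coef i) * Polynomial.X ^ (i : ℕ) with hPol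
      have hPev : ∀ x, Pol.eval x = ∑ i : Fin (t * D₀ + 1), coef i * x ^ (i : ℕ) := by
        intro x; simp [hPol, Polynomial.eval_finsetSum]
      have hPcoeff : ∀ i : Fin (t * D₀ + 1), Pol.coeff i = coef i := by
        intro i
        rw [hPol, Polynomial.finsetSum_coeff]
        simp only [Polynomial.coeff_C_mul_X_pow]
        rw [Finset.sum_eq_single i]
        · simp
        · intro i' _ hi'
          rw [if_neg]
          exact fun h => hi' (Fin.ext h.symm)
        · intro h; exact absurd (Finset.mem_univ _) h
      have hP0 : Pol = 0 := by
        apply Polynomial.funext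
        intro x
        rw [hPev, Polynomial.eval_zero, ← hval x y]
        exact hQ𝔭 _ (mem_of_addPart H₀ hirr hadd x hy)
      intro i
      change coef i = 0
      rw [← hPcoeff i, hP0, Polynomial.coeff_zero]
    -- Step 2: Artin
    have hcf : ∀ ic, cf ic = 0 := by
      rintro ⟨i, c⟩
      have hliφ := (linearIndependent_monoidHom (↥Hs) ℂ).comp _ (hinj i)
      have h0 := Fintype.linearIndependent_iff.mp hliφ (fun c => cf (i, c)) (by
        funext k
        simp only [Function.comp_apply, Finset.sum_apply, Pi.smul_apply, smul_eq_mul, Pi.zero_apply,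
          monChar_apply]
        have hk : ((1 : Multiplicative ℂ), (k : GaGm n).2) ∈ H₀ := by
          have : ((1 : Multiplicative ℂ), (k : GaGm n).2) = (k : GaGm n) := by ext <;> simp [k.2.2]
          rw [this]; exact k.2.1
        exact step1 _ hk i)
      exact h0 c
    simp [hcf]
  -- conclusion: `span fam ⊕ (Box ⊓ 𝔭) ≤ Box`
  set W := Submodule.span ℂ (Set.range fam) with hW
  have hWle : W ≤ Box (n := n) D₀ D₁ t := Submodule.span_le.mpr (by rintro _ ⟨ic, rfl⟩; exact hfamBox ic)
  have hWfin : finrank ℂ ↥W = Fintype.card I := finrank_span_eq_card hfamli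
  haveI : FiniteDimensional ℂ ↥W := FiniteDimensional.span_of_finite ℂ (Set.finite_range fam)
  haveI : FiniteDimensional ℂ ↥(Box (n := n) D₀ D₁ t ⊓ 𝔭.restrictScalars ℂ) :=
    Submodule.finiteDimensional_inf_left _ _
  have h1 := Submodule.finrank_sup_add_finrank_inf_eq W (Box (n := n) D₀ D₁ t ⊓ 𝔭.restrictScalars ℂ)
  have h2 : W ⊓ (Box (n := n) D₀ D₁ t ⊓ 𝔭.restrictScalars ℂ) = ⊥ := by
    rw [eq_bot_iff, ← hinf]
    exact le_inf inf_le_left (inf_le_right.trans inf_le_right)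
  rw [h2, finrank_bot, add_zero] at h1
  have h3 : finrank ℂ ↥(W ⊔ (Box (n := n) D₀ D₁ t ⊓ 𝔭.restrictScalars ℂ)) ≤ finrank ℂ ↥(Box (n := n) D₀ D₁ t) :=
    Submodule.finrank_mono (sup_le hWle inf_le_left)
  have h4 := hilbI_add_finrank_inf (n := n) (D₀ := D₀) (D₁ := D₁) (𝔭.restrictScalars ℂ) t
  rw [← hcardI, ← hWfin]
  change _ ≤ hilbI D₀ D₁ (𝔭.restrictScalars ℂ) t
  omega

/-! ### The dimension of `𝔾ₐ × T_{ℤλ}` is `n` -/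

/-- `dim {v ; ⟨λ, v⟩ = 0} = n - 1` for `λ ≠ 0`: the annihilator of a cyclic lattice is a
hyperplane. [folklore] -/
theorem finrank_tangentOf_zmultiples {lam : Fin n → ℤ} (hlam : lam ≠ 0) :
    finrank ℂ ↥(tangentOf (AddSubgroup.zmultiples lam)) = n - 1 := by
  classical
  -- the functional `v ↦ ⟨λ, v⟩`
  let φ : (Fin n → ℂ) →ₗ[ℂ] ℂ :=
    { toFun := fun v => ∑ j, (lam j : ℂ) * v j
      map_add' := fun v v' => by
        simp only [Pi.add_apply, mul_add, Finset.sum_add_distrib]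
      map_smul' := fun c v => by
        simp only [Pi.smul_apply, smul_eq_mul, RingHom.id_apply, Finset.mul_sum]
        refine Finset.sum_congr rfl fun j _ => ?_
        ring }
  have hker : LinearMap.ker φ = tangentOf (AddSubgroup.zmultiples lam) := by
    ext v
    simp only [LinearMap.mem_ker]
    change (∑ j, (lam j : ℂ) * v j = 0) ↔ ∀ χ ∈ AddSubgroup.zmultiples lam, ∑ j, (χ j : ℂ) * v j = 0
    constructor
    · intro h χ hχ
      rw [AddSubgroup.mem_zmultiples_iff] at hχ
      obtain ⟨k, rfl⟩ := hχ
      simp only [Pi.smul_apply, smul_eq_mul, Int.cast_mul, mul_assoc, ← Finset.mul_sum, h, mul_zero]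
    · intro h
      exact h lam (AddSubgroup.mem_zmultiples lam)
  -- `φ` is onto
  obtain ⟨j₀, hj₀⟩ : ∃ j₀, lam j₀ ≠ 0 := by
    by_contra h
    push Not at h
    exact hlam (funext h)
  have hsurj : LinearMap.range φ = ⊤ := by
    rw [LinearMap.range_eq_top]
    intro w
    refine ⟨Pi.single j₀ (w / lam j₀), ?_⟩
    change ∑ j, (lam j : ℂ) * (Pi.single j₀ (w / (lam j₀ : ℂ)) : Fin n → ℂ) j = w
    rw [Finset.sum_eq_single j₀]
    · rw [Pi.single_eq_same, mul_div_cancel₀ _ (Int.cast_ne_zero.mpr hj₀)]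
    · intro j _ hj; rw [Pi.single_eq_of_ne hj, mul_zero]
    · intro h; exact absurd (Finset.mem_univ _) h
  have h := LinearMap.finrank_range_add_finrank_ker φ
  rw [hsurj, finrank_top, Module.finrank_self, Module.finrank_fin_fun, hker] at h
  omega

/-- **`dim (𝔾ₐ × T_{ℤλ}) = n`** for `λ ≠ 0`. [folklore] -/
theorem dimG_eq_of_charGroup_eq_zmultiples (H₀ : Subgroup (GaGm n)) (hirr : IsIrred (H₀ : Set (GaGm n)))
    (hadd : (toConnAlgSubgroup H₀ hirr).addPart = true) {lam : Fin n → ℤ}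
    (hlam : charGroup (H₀ : Set (GaGm n)) = AddSubgroup.zmultiples lam) (hlam0 : lam ≠ 0) :
    dimG (H₀ : Set (GaGm n)) = n := by
  obtain ⟨j₀, hj₀⟩ : ∃ j₀, lam j₀ ≠ 0 := by
    by_contra h
    push Not at h
    exact hlam0 (funext h)
  have hn : 1 ≤ n := Nat.one_le_iff_ne_zero.mpr fun h0 => by subst h0; exact j₀.elim0
  rw [dimG_eq_addDim_add_torusDim H₀ hirr, ConnAlgSubgroup.addDim, hadd, if_pos rfl,
    ConnAlgSubgroup.torusDim, torusTangent_eq_tangentOf, toConnAlgSubgroup_chars, hlam,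
    finrank_tangentOf_zmultiples hlam0]
  omega

/-! ### Arithmetic of the lower bound -/

/-- `n!·binom(t - A, n)·D₀D₁ⁿ⁻¹·A ≤ (tD₀ + 1)·A·(tD₁ + 1 - A)ⁿ⁻¹` for `t ≥ A + n`, `n, D₁ ≥ 1`.
[folklore] -/
theorem lower_bound_arith {n D₀ D₁ A t : ℕ} (hn : 1 ≤ n) (hD₁ : 1 ≤ D₁) (ht : A + n ≤ t) :
    n.factorial * D₀ * D₁ ^ (n - 1) * A * (t - (A + n) + n).choose n ≤
      (t * D₀ + 1) * (A * (t * D₁ + 1 - A) ^ (n - 1)) := by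
  have hsub : t - (A + n) + n = t - A := by omega
  rw [hsub]
  have h1 : n.factorial * (t - A).choose n ≤ (t - A) ^ n := by
    rw [← Nat.descFactorial_eq_factorial_mul_choose]; exact Nat.descFactorial_le_pow _ _
  have hpow : (t - A) ^ n = (t - A) * (t - A) ^ (n - 1) := by
    rw [← pow_succ', Nat.sub_add_cancel hn]
  have hx : D₀ * (t - A) ≤ t * D₀ + 1 := by
    have := Nat.mul_le_mul_left D₀ (Nat.sub_le t A)
    rw [mul_comm t D₀]; omega
  have hy : D₁ * (t - A) ≤ t * D₁ + 1 - A := by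
    have e : D₁ * (t - A) + D₁ * A = D₁ * t := by rw [← Nat.mul_add, Nat.sub_add_cancel (by omega)]
    have hA : A ≤ D₁ * A := Nat.le_mul_of_pos_left A hD₁
    rw [mul_comm t D₁]; omega
  calc n.factorial * D₀ * D₁ ^ (n - 1) * A * (t - A).choose n
      = (n.factorial * (t - A).choose n) * (D₀ * D₁ ^ (n - 1) * A) := by ring
    _ ≤ (t - A) ^ n * (D₀ * D₁ ^ (n - 1) * A) := Nat.mul_le_mul_right _ h1
    _ = (D₀ * (t - A)) * (A * (D₁ * (t - A)) ^ (n - 1)) := by rw [hpow, mul_pow]; ring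
    _ ≤ (t * D₀ + 1) * (A * (t * D₁ + 1 - A) ^ (n - 1)) :=
        Nat.mul_le_mul hx (Nat.mul_le_mul_left _ (Nat.pow_le_pow_left hy _))

end MultBound

/-! ### The multiplicity bound -/

open MultBound in
/-- **Multiplicity of `𝔾ₐ × T_λ` (Philippon 1986, the value `H(G'; D) = n!·D₀D₁ⁿ⁻¹·∑_h|λ_h|`
behind conclusion (ii) of `Philippon1986_GaGm_P1n`).** For an irreducible closed subgroup
`H₀ ≤ ℂ × (ℂˣ)ⁿ` with non-trivial additive part and cyclic character lattice
`charGroup H₀ = ℤλ`, the bidegree-`(D₀, D₁)` multiplicity of `GaGmBezout.lean` satisfies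
`n! · D₀ · D₁ⁿ⁻¹ · ∑_h |λ_h| ≤ mult_{D₀,D₁}(H₀)`.
[cite: Philippon1986, Thm 2.1 with §3 (*) p. 362 and Lemme 3.4 p. 371 (G' = 𝔾ₐ × T_λ ⊂ (ℙ¹)ⁿ⁺¹)] -/
theorem factorial_mul_le_mult_of_charGroup_eq_zmultiples {D₀ D₁ : ℕ} (hD₀ : 1 ≤ D₀) (hD₁ : 1 ≤ D₁)
    (H₀ : Subgroup (GaGm n)) (hirr : IsIrred (H₀ : Set (GaGm n)))
    (hadd : (toConnAlgSubgroup H₀ hirr).addPart = true) {lam : Fin n → ℤ}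
    (hlam : charGroup (H₀ : Set (GaGm n)) = AddSubgroup.zmultiples lam) :
    n.factorial * D₀ * D₁ ^ (n - 1) * (∑ h, (lam h).natAbs) ≤ mult D₀ D₁ (H₀ : Set (GaGm n)) := by
  classical
  set A := ∑ h, (lam h).natAbs with hA
  rcases Nat.eq_zero_or_pos A with hA0 | hApos
  · rw [hA0, mul_zero]; exact Nat.zero_le _
  -- `λ ≠ 0`, `n ≥ 1`
  have hlam0 : lam ≠ 0 := by
    rintro rfl
    simp [hA] at hApos
  obtain ⟨j₀, hj₀⟩ : ∃ j₀, lam j₀ ≠ 0 := by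
    by_contra h
    push Not at h
    exact hlam0 (funext h)
  have hn : 1 ≤ n := Nat.one_le_iff_ne_zero.mpr fun h0 => by subst h0; exact j₀.elim0
  -- the sandwich with `m = n`
  obtain ⟨hHM, -⟩ := hirr.hasMult (D₀ := D₀) (D₁ := D₁) hD₀ hD₁
  obtain ⟨a, γ, hb⟩ := hHM
  rw [dimG_eq_of_charGroup_eq_zmultiples H₀ hirr hadd hlam hlam0] at hb
  -- the lower bound `ρ₀ · binom(t - (A + n) + n, n) ≤ H(t)` for `t ≥ A + n`
  set ρ₀ := n.factorial * D₀ * D₁ ^ (n - 1) * A with hρ₀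
  have hlow : ∀ t, A + n ≤ t → ρ₀ * (t - (A + n) + n).choose n ≤ hilb D₀ D₁ (H₀ : Set (GaGm n)) t := by
    intro t ht
    have hAt : A ≤ t * D₁ + 1 := by
      have : t ≤ t * D₁ := Nat.le_mul_of_pos_right t hD₁
      omega
    calc ρ₀ * (t - (A + n) + n).choose n
        ≤ (t * D₀ + 1) * (A * (t * D₁ + 1 - A) ^ (n - 1)) := lower_bound_arith hn hD₁ ht
      _ ≤ (t * D₀ + 1) * (minExp (t * D₁) lam).card :=
          Nat.mul_le_mul_left _ (hA ▸ sum_mul_pow_le_card_minExp (t * D₁) lam (hA ▸ hAt))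
      _ ≤ hilb D₀ D₁ (H₀ : Set (GaGm n)) t := mul_card_minExp_le_hilb D₀ D₁ H₀ hirr hadd hlam t
  -- comparison of leading coefficients
  have h := Asymp.sum_le_of_choose_ineq (Finset.univ : Finset Unit) (mult D₀ D₁ (H₀ : Set (GaGm n)))
    (fun _ => ρ₀) (fun _ => A + n) γ n (max a (A + n)) (fun t ht => by
      rw [Finset.sum_const, Finset.card_univ, Fintype.card_unit, one_smul]
      exact (hlow t (le_of_max_le_right ht)).trans (hb t (le_of_max_le_left ht)).2)
  rwa [Finset.sum_const, Finset.card_univ, Fintype.card_unit, one_smul] at h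

end GaGm

end Literature.NumberTheory.Transcendental
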